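import Summits.HodgeConjecture.CorCM.MumfordTateRankSevenSplitConverse
import Summits.HodgeConjecture.CorCM.MumfordTateRankSevenTypeThreeIsogeny
import HarnessLib

/-!
# The rung `dim MT(H¹(X)) = 7`, the split shape as an IFF: `X ∼ B₁^{a+1} × B₂^{b+1}` (`B₁ ≁ B₂` non-CM curves / quaternion
# surfaces) ⟺ `dim MT(H¹X) = 7`, `𝔷 = 0` and `Lie Hg(H¹X)` is NOT `ℚ`-simple

COR-CM (cell `pub-hodgecm2`, seat `b27` gen 42, count-neutral Mumford–Tate-rank ladder; theorems only, no definition, no named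
fact; UNCONDITIONAL — nothing here uses or asserts HC_CM).  Sequel of `CorCM/MumfordTateRankSevenSplitConverse` (the split shape
has `t = 7`, `𝔷 = 0`) and of the isotypy theorems of the `ℚ`-simple branch (`CorCM/MumfordTateRankSevenSimpleHodge`, gen 40:
positions (b) real multiplication, (c) quaternion fourfold; `CorCM/MumfordTateRankSevenTypeThreeIsogeny`, gen 41: position (a)
type III): in EVERY position of the simple branch `X ∼ B^{m+1}` is ISOTYPIC.

* **`not_isSimple_hodgeLie_of_isIsogenous_powSucc_prod_powSucc`** — for the split shape `Lie Hg(H¹X)` is NOT a simple Lie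
  algebra over `ℚ`: otherwise `X ∼ B^{m+1}` would be isotypic and the two non-isogenous simple `B₁, B₂ ≼ X` both isogenous
  to `B` (`exists_isIsogenous_of_isSimple_of_avDominatedBy_biproduct`).
* **`exists_split_shape_iff_of_pos_dim`** — for `0 < dim X`: the split shape (gen 39's eighteen-clause form) ⟺
  `dim MT(H¹X) = 7 ∧ 𝔷 = 0 ∧ ¬(Lie Hg(H¹X) ℚ-simple)` (⟸ is gen 39's dichotomy
  `isSimple_or_exists_isIsogenous_powSucc_prod_powSucc_of_center_eq_bot_of_mtRank_eq_seven`).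

## References

* [MoonenZarhin1999LowDim] B. Moonen, Yu. Zarhin, *Hodge classes on abelian varieties of low dimension*, Math. Ann.
  315 (1999), §1, §2 (2.1)–(2.3), §3 (3.1) and Cor. (3.7).
* [MumfordAV1970] D. Mumford, *Abelian Varieties* (1970), §19 Thm. 1, Cor. 1–2 (pp. 173–174).
-/

noncomputable section

open scoped TensorProduct
open CategoryTheory CategoryTheory.Limits Module

namespace Summit.HodgeConjecture.CorCM

open Literature.AlgebraicGeometry.Motives
open Literature.AlgebraicGeometry.Motives.AbelianVariety
open Literature.AlgebraicGeometry.Motives.HodgeStructure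
open Literature.AlgebraicGeometry.HodgeTheory
open Literature.AlgebraicGeometry.ComplexMultiplication (EndField)
open Literature.AlgebraicGeometry.Milne1999 (IsOfCMType dim_powSucc_pos)
open Literature.AlgebraicGeometry.Pohlmann1968 (isIsogenous_powSucc_biproduct)
open Summit.HodgeConjecture.CorCM.Domination
open Summit.HodgeConjecture.CorCM.SliceExhaustion (avDominatedBy_prod_left)

variable [HodgeTensorFacts.{0, 0}] {X : AbelianVariety ℂ} {n : ℕ}

/-- **In the `ℚ`-SIMPLE branch of the rung `dim MT(H¹X) = 7`, `𝔷 = 0`, `X` is ISOTYPIC: `X ∼ ⨁_{Fin (m+1)} B` with `B`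
simple** — position (a) type III by `exists_isIsogenous_power_of_isSimple_of_finrank_gradingPlus_eq_one`, positions (b)/(c) by
gen 40's trichotomy. [cite: MoonenZarhin1999LowDim, §2 (2.2)–(2.3)] [cite: MumfordAV1970, §19 Cor. 1–2 of Thm. 1 (pp. 173–174)] -/
theorem exists_isIsogenous_biproduct_const_of_isSimple_of_center_eq_bot_of_mtRank_eq_seven (hX : IsSmoothProjective n X.X)
    (h0 : 0 < X.dim)
    (hz : haveI := BettiUniverse.finite hX 1
      (BettiUniverse.hodge exists_isReal_hodgeModel_holds hX 1).hodgeLie ⊓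
        Subalgebra.toSubmodule (BettiUniverse.hodge exists_isReal_hodgeModel_holds hX 1).endAlg = ⊥)
    (h7 : haveI := BettiUniverse.finite hX 1
      (BettiUniverse.hodge exists_isReal_hodgeModel_holds hX 1).mtRank = 7)
    (hsimple : haveI := BettiUniverse.finite hX 1
      letI : LieRing (Module.End ℚ (bettiCohomology X.X 1)) := LieRing.ofAssociativeRing
      ∀ 𝔏 : LieSubalgebra ℚ (Module.End ℚ (bettiCohomology X.X 1)),
        𝔏.toSubmodule = (BettiUniverse.hodge exists_isReal_hodgeModel_holds hX 1).hodgeLie → LieAlgebra.IsSimple ℚ 𝔏) :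
    ∃ (B : AbelianVariety ℂ) (m : ℕ), B.IsSimple ∧ 0 < B.dim ∧ IsIsogenous X (⨁ fun _ : Fin (m + 1) => B) := by
  classical
  haveI := BettiUniverse.finite hX 1
  rcases trichotomy_of_isSimple_of_center_eq_bot_of_mtRank_eq_seven hX h0 hz h7 hsimple with
    ⟨S, hS, hD, deg, e, hF, hFc, ⟨hp1, hm1, -⟩, -⟩ | h | h
  · obtain ⟨B, m, -, hBs, hB0, hXB, -⟩ :=
      exists_isIsogenous_power_of_isSimple_of_finrank_gradingPlus_eq_one hX h0 hz h7 hsimple e hF hFc hp1 hm1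
    exact ⟨B, m, hBs, hB0, hXB⟩
  · obtain ⟨B, m, -, hBs, hB2, -, -, hXB, -⟩ := h
    exact ⟨B, m, hBs, by omega, hXB.trans (isIsogenous_powSucc_biproduct B m)⟩
  · obtain ⟨B, m, -, -, hBs, hB4, -, -, -, -, -, -, -, hXB, -⟩ := h
    exact ⟨B, m, hBs, by omega, hXB.trans (isIsogenous_powSucc_biproduct B m)⟩

/-- **For the split shape `X ∼ B₁^{a+1} × B₂^{b+1}` (`B₁ ≁ B₂` simple, not CM, `0 < dim Bᵢ ≤ 2`, `dim End⁰Bᵢ = (dim Bᵢ)²`,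
`Z(End⁰Bᵢ) = ℚ`) the Hodge Lie algebra `Lie Hg(H¹X)` is NOT a simple Lie algebra over `ℚ`** — it has `t = 7`, `𝔷 = 0`
(`mtRank_hodge_one_eq_seven_of_isIsogenous_powSucc_prod_powSucc`), and a simple `Lie Hg` would make `X ∼ B^{m+1}` isotypic,
with the two non-isogenous simple `B₁, B₂ ≼ X` both isogenous to `B`.  (So `Lie Hg(H¹X) = 𝔞 ⊕ 𝔟` is the sum of two
commuting three-dimensional ideals, by gen 39's dichotomy.) [cite: MoonenZarhin1999LowDim, §3 (3.1) and Cor. (3.7)]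
[cite: MumfordAV1970, §19 Thm. 1, Cor. 1–2 (pp. 173–174)] -/
theorem not_isSimple_hodgeLie_of_isIsogenous_powSucc_prod_powSucc (hX : IsSmoothProjective n X.X)
    {B₁ B₂ : AbelianVariety ℂ} (hB₁s : B₁.IsSimple) (hB₂s : B₂.IsSimple) (hB₁0 : 0 < B₁.dim) (hB₁2 : B₁.dim ≤ 2)
    (hB₂0 : 0 < B₂.dim) (hB₂2 : B₂.dim ≤ 2) (hB₁cm : ¬ IsOfCMType B₁) (hB₂cm : ¬ IsOfCMType B₂)
    (hE₁ : Module.finrank ℚ B₁.endAlgebra = B₁.dim ^ 2) (hZ₁ : Module.finrank ℚ (Subalgebra.center ℚ B₁.endAlgebra) = 1)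
    (hE₂ : Module.finrank ℚ B₂.endAlgebra = B₂.dim ^ 2) (hZ₂ : Module.finrank ℚ (Subalgebra.center ℚ B₂.endAlgebra) = 1)
    (h12 : ¬ IsIsogenous B₁ B₂) {a b : ℕ} (hXB : IsIsogenous X ((B₁.powSucc a).prod (B₂.powSucc b))) :
    haveI := BettiUniverse.finite hX 1
    letI : LieRing (Module.End ℚ (bettiCohomology X.X 1)) := LieRing.ofAssociativeRing
    ¬ ∀ 𝔏 : LieSubalgebra ℚ (Module.End ℚ (bettiCohomology X.X 1)),
        𝔏.toSubmodule = (BettiUniverse.hodge exists_isReal_hodgeModel_holds hX 1).hodgeLie → LieAlgebra.IsSimple ℚ 𝔏 := by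
  classical
  haveI := BettiUniverse.finite hX 1
  intro hsimple
  obtain ⟨h7, -, hz, -⟩ := mtRank_hodge_one_eq_seven_of_isIsogenous_powSucc_prod_powSucc hX hB₁s hB₂s hB₁0 hB₁2 hB₂0
    hB₂2 hB₁cm hB₂cm hE₁ hZ₁ hE₂ hZ₂ h12 hXB
  obtain ⟨g, hg⟩ := hXB
  have h0 : 0 < X.dim := by
    rw [dim_eq_of_isIsogeny hg, dim_prod]
    have := dim_powSucc_pos hB₁0 a
    omega
  obtain ⟨B, m, hBs, -, ⟨f, hf⟩⟩ :=
    exists_isIsogenous_biproduct_const_of_isSimple_of_center_eq_bot_of_mtRank_eq_seven hX h0 hz h7 hsimple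
  have hdom₁ : AVDominatedBy B₁ (⨁ fun _ : Fin (m + 1) => B) :=
    ((((avDominatedBy_powSucc_of_le B₁ (Nat.zero_le a)).trans (avDominatedBy_prod_left _ _)).trans_isIsogeny_inv
      hg).trans_isIsogeny_hom hf)
  have hdom₂ : AVDominatedBy B₂ (⨁ fun _ : Fin (m + 1) => B) :=
    ((((avDominatedBy_powSucc_of_le B₂ (Nat.zero_le b)).trans (avDominatedBy_prod_right _ _)).trans_isIsogeny_inv
      hg).trans_isIsogeny_hom hf)
  obtain ⟨-, h₁⟩ := exists_isIsogenous_of_isSimple_of_avDominatedBy_biproduct (fun _ => hBs) hB₁s hB₁0 hdom₁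
  obtain ⟨-, h₂⟩ := exists_isIsogenous_of_isSimple_of_avDominatedBy_biproduct (fun _ => hBs) hB₂s hB₂0 hdom₂
  exact h12 (h₁.trans h₂.symm')

/-- **The split rung as an IFF.**  For a complex abelian variety `X` with `0 < dim X`: `X ∼ B₁^{a+1} × B₂^{b+1}` with `B₁ ≁ B₂`
SIMPLE, NOT of CM type, `0 < dim Bᵢ ≤ 2`, `dim_ℚ End⁰Bᵢ = (dim Bᵢ)²`, `Z(End⁰Bᵢ) = ℚ`, `Hom(B₁, B₂) = 0 = Hom(B₂, B₁)` (gen 39's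
eighteen-clause split shape) **if and only if** `dim MT(H¹X) = 7`, `𝔷 = Lie Hg ∩ End_Hdg = 0` and `Lie Hg(H¹X)` is NOT
`ℚ`-simple.  (⟸: gen 39's dichotomy; ⟹: `mtRank_hodge_one_eq_seven_of_isIsogenous_powSucc_prod_powSucc` and
`not_isSimple_hodgeLie_of_isIsogenous_powSucc_prod_powSucc`.)  Moonen–Zarhin's `Hg = SL₂ × SL₂` products of two
non-isogenous elliptic curves without CM / quaternion surfaces, characterised by the Hodge Lie algebra.
[cite: MoonenZarhin1999LowDim, §2 (2.1)–(2.2), §3 (3.1) and Cor. (3.7)] [cite: MumfordAV1970, §19 Thm. 1, Cor. 1–2 (pp. 173–174)] -/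
theorem exists_split_shape_iff_of_pos_dim (hX : IsSmoothProjective n X.X) (h0 : 0 < X.dim) :
    (∃ (B₁ B₂ : AbelianVariety ℂ) (a b : ℕ), B₁.IsSimple ∧ B₂.IsSimple ∧ 0 < B₁.dim ∧ B₁.dim ≤ 2 ∧ 0 < B₂.dim ∧
        B₂.dim ≤ 2 ∧ ¬ IsOfCMType B₁ ∧ ¬ IsOfCMType B₂ ∧
        Module.finrank ℚ B₁.endAlgebra = B₁.dim ^ 2 ∧ Module.finrank ℚ (Subalgebra.center ℚ B₁.endAlgebra) = 1 ∧
        Module.finrank ℚ B₂.endAlgebra = B₂.dim ^ 2 ∧ Module.finrank ℚ (Subalgebra.center ℚ B₂.endAlgebra) = 1 ∧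
        (∀ f : B₁ ⟶ B₂, f = 0) ∧ (∀ f : B₂ ⟶ B₁, f = 0) ∧ ¬ IsIsogenous B₁ B₂ ∧
        IsIsogenous X ((B₁.powSucc a).prod (B₂.powSucc b)) ∧ (a + 1) * B₁.dim + (b + 1) * B₂.dim = X.dim ∧
        ¬ IsOfCMType X) ↔
      haveI := BettiUniverse.finite hX 1
      letI : LieRing (Module.End ℚ (bettiCohomology X.X 1)) := LieRing.ofAssociativeRing
      (BettiUniverse.hodge exists_isReal_hodgeModel_holds hX 1).mtRank = 7 ∧
        (BettiUniverse.hodge exists_isReal_hodgeModel_holds hX 1).hodgeLie ⊓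
          Subalgebra.toSubmodule (BettiUniverse.hodge exists_isReal_hodgeModel_holds hX 1).endAlg = ⊥ ∧
        ¬ ∀ 𝔏 : LieSubalgebra ℚ (Module.End ℚ (bettiCohomology X.X 1)),
          𝔏.toSubmodule = (BettiUniverse.hodge exists_isReal_hodgeModel_holds hX 1).hodgeLie → LieAlgebra.IsSimple ℚ 𝔏 := by
  haveI := BettiUniverse.finite hX 1
  constructor
  · rintro ⟨B₁, B₂, a, b, hB₁s, hB₂s, hB₁0, hB₁2, hB₂0, hB₂2, hB₁cm, hB₂cm, hE₁, hZ₁, hE₂, hZ₂, -, -, h12, hXB, -, -⟩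
    obtain ⟨h7, -, hz, -⟩ := mtRank_hodge_one_eq_seven_of_isIsogenous_powSucc_prod_powSucc hX hB₁s hB₂s hB₁0 hB₁2 hB₂0
      hB₂2 hB₁cm hB₂cm hE₁ hZ₁ hE₂ hZ₂ h12 hXB
    exact ⟨h7, hz, not_isSimple_hodgeLie_of_isIsogenous_powSucc_prod_powSucc hX hB₁s hB₂s hB₁0 hB₁2 hB₂0 hB₂2 hB₁cm
      hB₂cm hE₁ hZ₁ hE₂ hZ₂ h12 hXB⟩
  · rintro ⟨h7, hz, hns⟩
    rcases isSimple_or_exists_isIsogenous_powSucc_prod_powSucc_of_center_eq_bot_of_mtRank_eq_seven hX h0 hz h7 with h | h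
    · exact absurd h hns
    · exact h

end Summit.HodgeConjecture.CorCM

end
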